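import Literature.Combinatorics.SimpleGraph.GraphInvolutionQuotient
import Literature.Combinatorics.SimpleGraph.HyperellipticGraphs
import Literature.Combinatorics.SimpleGraph.HarmonicMorphismsJacobianInjective
import Literature.Combinatorics.SimpleGraph.JacobianTrivialTrees
import HarnessLib

/-!
# Hyperelliptic graphs, involutions and harmonic morphisms: Theorem 51, the hyperelliptic
# involution and its uniqueness (Baker–Norine 2009, §5.2: Theorem 51, Corollaries 53, 54,
# Remark 56)

Source (held, read at the page; statements VERBATIM). M. Baker, S. Norine, *Harmonic morphisms
and hyperelliptic graphs*, Int. Math. Res. Not. IMRN 2009, no. 15, 2914–2955 [BakerNorine2009]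
(held text `paper:arxiv-0707.1309`, chunks p0018–p0019).
**Theorem 51.** «For a 2-edge-connected graph `G` of genus `g ≥ 2`, the following conditions are
equivalent: (1) `G` is hyperelliptic. (2) There exists an involution `ι : G → G` such that `G/ι`
is a tree. (3) There exists a non-degenerate degree two harmonic morphism `φ` from `G` to a tree,
or `|V(G)| = 2`.» Proof of (1) ⇒ (2): «Let `D` be a divisor of degree `2` on `G` with `r(D) = 1`.
For every `x ∈ V(G)`, we have `|D − (x)| ≠ ∅` and `deg(D − (x)) = 1`. Since `G` is
2-edge-connected, there exists a unique `y ∈ V(G)` such that `D − (x) ∼ (y)`. Define `ι(x) = y`.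
[…] Consider an edge `e = xy ∈ E(G)`. […] If `ι(x) ≠ y`, then let `D₁ = (x) + (ι(x))` and let
`D₂ = (y) + (ι(y))`. […] there exists a non-constant function `f : V(G) → ℤ` such that
`D₁ − D₂ = div(f)`. Let `M(f)` be the set of all the vertices `z ∈ V(G)` for which `f(z)` is
maximal. For every vertex `z ∈ M(f)`, we have
`D₁(z) ≥ (div(f))(z) ≥ |{e′ = zz′ ∈ E(G) | z′ ∈ V(G) ∖ M(f)}|`. Therefore `deg(D₁) ≥ |δ(M(f))|`
[…]. On the other hand, `|δ(M(f))| ≥ 2` by the 2-edge connectivity of `G`. It follows that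
`|δ(M(f))| = 2`, and that `x, ι(x) ∈ M(f)`. Analogously […] `y, ι(y) ∈ V(G) ∖ M(f)`. It follows
that `e ∈ δ(M(f))`. Define `ι(e)` to be the unique edge `e*` such that `δ(M(f)) = {e, e*}`. […] we
conclude that `e*` joins `ι(x)` and `ι(y)`. Therefore `ι` is an automorphism […]. By Lemma 45, we
know that `φ = ι^∼` is a harmonic morphism. For every `x, y ∈ V(G/ι)` we have
`φ^*((x)) = (x) + (ι(x)) ∼ D ∼ (y) + (ι(y)) = φ^*((y))`. Therefore, by Theorem 30, we have
`(x) ∼ (y)` for all `x, y`. It follows from Lemma 1 that `G/ι` is a tree.» (2) ⇒ (3): «For every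
edge `e = xy ∈ E(G)` such that `x ≠ ι(y)`, the set of edges `{e, ι(e)}` is the preimage of an edge
of `G/ι`, and therefore forms a cut in `G`. It follows that `e ≠ ι(e)`, and therefore `ι` is
mixing.» (3) ⇒ (1): «Let `y₀ ∈ V(T)` be chosen arbitrarily and let `D := φ^*((y₀))`. […]
`(φ(x)) ∼ (y₀)`, and […] `D ∼ φ^*((φ(x))) ≥ m_φ(x)(x)`. […] `|D − (x)| ≠ ∅` as desired.»
**Corollary 53.** «If `G` is a 2-edge-connected hyperelliptic graph, then for any involution `ι`
for which `G/ι` is a tree, we have `(x) + (ι(x)) ∼ (y) + (ι(y))` for all `x, y ∈ V(G)`. In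
particular, `r((x) + (ι(x))) = 1` for all `x ∈ V(G)`.» **Corollary 54.** «If `G` is a
2-edge-connected graph of genus at least `2`, then there is at most one involution `ι` of `G`
whose quotient is a tree.» «If `G` is a 2-edge-connected hyperelliptic graph, we call the unique
involution `ι` whose quotient is a tree the hyperelliptic involution on `G`.» **Remark 56.** «if
`G` is a 2-edge-connected hyperelliptic graph and `r((x) + (y)) = 1` for some `x, y ∈ V(G)`, then
`y = ι(x)`.»

## What is formalised (simple graphs; vocabulary of `HyperellipticGraphs`,
## `GraphInvolutionQuotient`; «`G/ι` is a tree» = `(quotientGraph G ι).IsTree ∧ HasSimpleEdgeOrbits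
## G ι`, see that file; 2-edge-connected = Mathlib `G.IsEdgeConnected 2`)

* §1 the cut computation of the proof of (1) ⇒ (2) (`cut_eq_of_linEquiv`);
* §2 the involution `hypInvolution G D` of a degree-`2` divisor `D` with `r(D) = 1` («Define
  `ι(x) = y`»): well defined and involutive on a 2-edge-connected graph, `(x) + (ι x) ∼ D`, and the
  edge analysis: `ι` is an automorphism, mixing, with simple edge orbits;
* §3 (2) ⇒ (3): an involution with tree quotient on a 2-edge-connected graph is mixing
  (`isMixing_of_isTree_quotientGraph`, the cut `{e, ι(e)}`), hence (Lemma 45) its orbit map is a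
  non-degenerate degree-two harmonic morphism onto the tree `G/ι`;
* §4 (3) ⇒ (1) (`isHyperelliptic_of_hasDegreeTwoMapToTree`);
* §5 (1) ⇒ (2) (`isTree_quotientGraph_hypInvolution`, through Theorem 30 and Lemma 1) and
  **Theorem 51** as the equivalences `isHyperelliptic_iff_hasTreeInvolution`,
  `isHyperelliptic_iff_hasDegreeTwoMapToTree`;
* §6 **Corollary 53**, **Corollary 54** (uniqueness), **Remark 56**, and the identification of any
  tree involution with `hypInvolution G D`.

Definitions with bodies (`hypInvolution`, the Props `HasTreeInvolution`, `HasDegreeTwoMapToTree`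
naming conditions (2), (3)) and theorems; no `sorry`; no named facts; no instances.
-/

open Finset SimpleGraph Matrix
open Literature.Combinatorics.SimpleGraph.ChipFiring

namespace Literature.Combinatorics.SimpleGraph.BakerNorine

universe u

variable {V : Type u} [Fintype V] [DecidableEq V] {G : SimpleGraph V} [DecidableRel G.Adj]

/-! ### §0 Two-point divisors `(x) + (y)` -/

omit [Fintype V] in
/-- `((x) + (y))(z)`. [cite: BakerNorine2009, §1.3] -/
theorem single_add_single_apply (x y z : V) :
    (Pi.single x 1 + Pi.single y 1 : V → ℤ) z = (if z = x then 1 else 0) + if z = y then 1 else 0 := by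
  simp [Pi.single_apply]

omit [Fintype V] in
/-- `(x) + (y) ≥ 0`. [cite: BakerNorine2009, §1.3] -/
theorem single_add_single_nonneg (x y : V) : (0 : V → ℤ) ≤ Pi.single x 1 + Pi.single y 1 :=
  fun z => by
    simp only [Pi.zero_apply, Pi.add_apply, Pi.single_apply]
    split_ifs <;> norm_num

/-- `deg((x) + (y)) = 2`. [cite: BakerNorine2009, §1.3] -/
theorem sum_single_add_single (x y : V) : ∑ z, (Pi.single x 1 + Pi.single y 1 : V → ℤ) z = 2 := by
  simp only [Pi.add_apply, Finset.sum_add_distrib, Finset.sum_pi_single', mem_univ, if_true]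
  norm_num

/-! ### §1 The cut computation in the proof of (1) ⇒ (2) -/

section Cut

variable [Nonempty V]

/-- **The cut computation** («For every vertex `z ∈ M(f)`, we have
`D₁(z) ≥ (div(f))(z) ≥ |{e′ = zz′ : z′ ∉ M(f)}|`. Therefore `deg(D₁) ≥ |δ(M(f))|` […]
`|δ(M(f))| ≥ 2` by the 2-edge connectivity of `G`. It follows that `|δ(M(f))| = 2`»): for
effective `D₁, D₂` with `deg D₁ = 2`, `D₂ = D₁ − div(f)`, `f` non-constant, on a 2-edge-connected
graph: `D₁` vanishes off `M(f)`, `D₂` vanishes on `M(f)`, `D₁(z)` is the number of cut edges at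
`z ∈ M(f)`, and every cut edge drops `f` by exactly `1`.
[cite: BakerNorine2009, Theorem 51 (proof of (1) ⇒ (2))] -/
theorem cut_eq_of_linEquiv (h2 : G.IsEdgeConnected 2) {D₁ D₂ f : V → ℤ} (hD₁ : 0 ≤ D₁)
    (hD₂ : 0 ≤ D₂) (hs : ∑ v, D₁ v = 2) (hf : D₂ = D₁ - G.lapMatrix ℤ *ᵥ f)
    (hnc : fnMin f < fnMax f) :
    (∀ z, z ∉ maxLocus f → D₁ z = 0) ∧ (∀ z ∈ maxLocus f, D₂ z = 0) ∧
      (∀ z ∈ maxLocus f, D₁ z = #{u ∈ G.neighborFinset z | u ∉ maxLocus f}) ∧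
      ∀ z ∈ maxLocus f, ∀ u, G.Adj z u → u ∉ maxLocus f → f u = fnMax f - 1 := by
  set M := maxLocus f with hM
  have hΔ : ∀ z, (G.lapMatrix ℤ *ᵥ f) z = D₁ z - D₂ z := fun z => by
    have := congrFun hf z
    simp only [Pi.sub_apply] at this
    linarith
  have hc : ∀ z ∈ M, (#{u ∈ G.neighborFinset z | u ∉ M} : ℤ) ≤ D₁ z - D₂ z := fun z hz => by
    rw [← hΔ]
    exact card_filter_le_lapMatrix_mulVec_of_mem_maxLocus f hz
  -- `M` is a non-empty proper vertex set, so its cut has at least two edges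
  obtain ⟨a, ha⟩ := exists_eq_fnMax f
  obtain ⟨b, hb⟩ := exists_eq_fnMin f
  have haM : a ∈ M := mem_maxLocus.2 ha
  have hbM : b ∉ M := fun h => by rw [mem_maxLocus] at h; omega
  have hcut : (2 : ℤ) ≤ ∑ z ∈ M, (#{u ∈ G.neighborFinset z | u ∉ M} : ℤ) := by
    have h := (isEdgeConnected_iff_forall_le_sum (G := G) 2).1 h2 M ⟨a, haM⟩
      ⟨b, Finset.mem_compl.2 hbM⟩
    have h' : ∀ z, #(G.neighborFinset z \ M) = #{u ∈ G.neighborFinset z | u ∉ M} := fun z => by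
      rw [Finset.sdiff_eq_filter]
    simp only [h'] at h
    exact_mod_cast h
  -- the chain `2 ≤ Σ_M c ≤ Σ_M (D₁ − D₂) ≤ Σ_M D₁ ≤ Σ_V D₁ = 2`
  have h1 : ∑ z ∈ M, (#{u ∈ G.neighborFinset z | u ∉ M} : ℤ) ≤ ∑ z ∈ M, (D₁ z - D₂ z) :=
    Finset.sum_le_sum hc
  have hle2 : ∀ z ∈ M, D₁ z - D₂ z ≤ D₁ z := fun z _ => by
    have : (0 : ℤ) ≤ D₂ z := hD₂ z
    linarith
  have h2' : ∑ z ∈ M, (D₁ z - D₂ z) ≤ ∑ z ∈ M, D₁ z := Finset.sum_le_sum hle2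
  have h3 : ∑ z ∈ M, D₁ z ≤ ∑ z, D₁ z :=
    Finset.sum_le_sum_of_subset_of_nonneg (subset_univ M) fun z _ _ => hD₁ z
  have e1 : ∑ z ∈ M, (#{u ∈ G.neighborFinset z | u ∉ M} : ℤ) = ∑ z ∈ M, (D₁ z - D₂ z) := by
    linarith
  have e2 : ∑ z ∈ M, (D₁ z - D₂ z) = ∑ z ∈ M, D₁ z := by linarith
  have e3 : ∑ z ∈ M, D₁ z = ∑ z, D₁ z := by linarith
  have t1 := (Finset.sum_eq_sum_iff_of_le hc).1 e1
  have t2 := (Finset.sum_eq_sum_iff_of_le hle2).1 e2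
  refine ⟨fun z hz => ?_, fun z hz => ?_, fun z hz => ?_, fun z hz u hzu hu => ?_⟩
  · -- `D₁` vanishes off `M`
    have h0 : ∑ z ∈ univ \ M, D₁ z = 0 := by
      have := Finset.sum_sdiff (subset_univ M) (f := D₁)
      linarith
    exact (Finset.sum_eq_zero_iff_of_nonneg fun w _ => hD₁ w).1 h0 z
      (Finset.mem_sdiff.2 ⟨mem_univ z, hz⟩)
  · have := t2 z hz
    linarith
  · have := t1 z hz
    have := t2 z hz
    linarith
  · -- every cut edge at `z ∈ M` drops `f` by exactly one
    have hz' := mem_maxLocus.1 hz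
    have heq : (G.lapMatrix ℤ *ᵥ f) z = #{u ∈ G.neighborFinset z | u ∉ M} := by
      rw [hΔ, ← t1 z hz]
    rw [lapMatrix_mulVec_eq_sum_sub, Finset.natCast_card_filter] at heq
    have hle : ∀ w ∈ G.neighborFinset z, (if w ∉ M then (1 : ℤ) else 0) ≤ f z - f w := by
      intro w _
      have hw := le_fnMax f w
      by_cases h : w ∈ M
      · rw [if_neg (not_not.2 h)]; omega
      · rw [if_pos h]; rw [mem_maxLocus] at h; omega
    have := (Finset.sum_eq_sum_iff_of_le hle).1 heq.symm u ((mem_neighborFinset _ _ _).2 hzu)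
    rw [if_pos hu] at this
    omega

end Cut

/-! ### §2 The involution of a degree-two divisor with `r(D) = 1` -/

open Classical in
/-- **The involution of `D`**: «Since `G` is 2-edge-connected, there exists a unique `y ∈ V(G)`
such that `D − (x) ∼ (y)`. Define `ι(x) = y`» (some such `y`; `x` itself if there is none).
[cite: BakerNorine2009, Theorem 51 (proof of (1) ⇒ (2))] -/
noncomputable def hypInvolution (G : SimpleGraph V) [DecidableRel G.Adj] (D : V → ℤ) (x : V) : V :=
  if h : ∃ y, LinEquiv G (D - Pi.single x 1) (Pi.single y 1) then h.choose else x

/-- «For every `x ∈ V(G)`, we have `|D − (x)| ≠ ∅` and `deg(D − (x)) = 1`»: `D − (x) ∼ (y)` for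
some `y` when `r(D) ≥ 1`. [cite: BakerNorine2009, Theorem 51 (proof of (1) ⇒ (2))] -/
theorem exists_linEquiv_sub_single (hG : G.Connected) {D : V → ℤ} (hD : ∑ v, D v = 2)
    (hr : 1 ≤ rank G D) (x : V) : ∃ y, LinEquiv G (D - Pi.single x 1) (Pi.single y 1) := by
  haveI : Nonempty V := hG.nonempty
  have hx1 : (0 : V → ℤ) ≤ Pi.single x 1 := fun v => by
    by_cases hv : v = x
    · subst hv; simp
    · simp [hv]
  obtain ⟨F, hF, hDF⟩ := (le_rank_iff G D 1).1 (by exact_mod_cast hr) (Pi.single x 1) hx1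
    (by rw [Finset.sum_pi_single']; simp)
  have hFs : ∑ v, F v = 1 := by
    rw [← hDF.sum_eq]
    simp only [Pi.sub_apply, Finset.sum_sub_distrib, hD, Finset.sum_pi_single', mem_univ, if_true]
    norm_num
  obtain ⟨y, rfl⟩ := eq_single_of_nonneg_of_sum_eq_one hF hFs
  exact ⟨y, hDF⟩

section HypInvolution

variable (hG : G.Connected) (h2 : G.IsEdgeConnected 2) {D : V → ℤ} (hD : ∑ v, D v = 2)
  (hr : 1 ≤ rank G D)
include hG hD hr

/-- `D − (x) ∼ (ι(x))`, i.e. `D ∼ (x) + (ι(x))`. [cite: BakerNorine2009, Theorem 51 (proof)] -/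
theorem linEquiv_single_add_hypInvolution (x : V) :
    LinEquiv G D (Pi.single x 1 + Pi.single (hypInvolution G D x) 1) := by
  have hex := exists_linEquiv_sub_single hG hD hr x
  have h : LinEquiv G (D - Pi.single x 1) (Pi.single (hypInvolution G D x) 1) := by
    rw [hypInvolution, dif_pos hex]
    exact hex.choose_spec
  have := h.add_right (Pi.single x 1)
  rwa [sub_add_cancel, add_comm] at this

/-- `(x) + (ι x) ∼ (y) + (ι y)` for all `x, y`. [cite: BakerNorine2009, Theorem 51 (proof:
«`φ^*((x)) = (x) + (ι(x)) ∼ D ∼ (y) + (ι(y))`»)] -/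
theorem linEquiv_pair_hypInvolution (x y : V) :
    LinEquiv G (Pi.single x 1 + Pi.single (hypInvolution G D x) 1)
      (Pi.single y 1 + Pi.single (hypInvolution G D y) 1) :=
  (linEquiv_single_add_hypInvolution hG hD hr x).symm.trans
    (linEquiv_single_add_hypInvolution hG hD hr y)

include h2

/-- Uniqueness: «Since `G` is 2-edge-connected, there exists a unique `y` such that
`D − (x) ∼ (y)`»; so `D − (x) ∼ (y)` forces `ι(x) = y`. [cite: BakerNorine2009, Theorem 51
(proof), with Theorem 7] -/
theorem hypInvolution_eq_of_linEquiv {x y : V} (h : LinEquiv G (D - Pi.single x 1) (Pi.single y 1)) :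
    hypInvolution G D x = y := by
  have h1 := linEquiv_single_add_hypInvolution hG hD hr x
  have h1' : LinEquiv G (D - Pi.single x 1) (Pi.single (hypInvolution G D x) 1) := by
    have := h1.sub_right (Pi.single x 1)
    rwa [add_sub_cancel_left] at this
  exact (linEquiv_single_imp_eq_iff_isEdgeConnected_two hG).2 h2 _ _ (h1'.symm.trans h)

/-- `ι` is an involution: `ι(ι(x)) = x`. [cite: BakerNorine2009, Theorem 51 (proof: «clearly
`ι ∘ ι` is the identity»)] -/
theorem hypInvolution_hypInvolution (x : V) : hypInvolution G D (hypInvolution G D x) = x := by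
  apply hypInvolution_eq_of_linEquiv hG h2 hD hr
  have := (linEquiv_single_add_hypInvolution hG hD hr x).sub_right
    (Pi.single (hypInvolution G D x) 1)
  rwa [add_sub_cancel_right] at this

/-- **The edge analysis of (1) ⇒ (2)**: for an edge `xy` with `y ≠ ι(x)`, `ι(x)ι(y)` is an edge
(«`e*` joins `ι(x)` and `ι(y)`»), the cut `δ(M(f)) = {e, e*}` has only these two edges — so
`x ∼ ι(y)` forces `ι(x) = x` or `ι(y) = y` — and `x, y` are not both fixed.
[cite: BakerNorine2009, Theorem 51 (proof of (1) ⇒ (2))] -/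
theorem hypInvolution_edge {x y : V} (hxy : G.Adj x y) (hy : y ≠ hypInvolution G D x) :
    G.Adj (hypInvolution G D x) (hypInvolution G D y) ∧
      (G.Adj x (hypInvolution G D y) → hypInvolution G D x = x ∨ hypInvolution G D y = y) ∧
      ¬ (hypInvolution G D x = x ∧ hypInvolution G D y = y) := by
  haveI : Nonempty V := hG.nonempty
  set ι := hypInvolution G D with hιdef
  have hinv : ∀ z, ι (ι z) = z := hypInvolution_hypInvolution hG h2 hD hr
  set D₁ : V → ℤ := Pi.single x 1 + Pi.single (ι x) 1 with hD₁
  set D₂ : V → ℤ := Pi.single y 1 + Pi.single (ι y) 1 with hD₂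
  have hD₁0 : (0 : V → ℤ) ≤ D₁ := single_add_single_nonneg _ _
  have hD₂0 : (0 : V → ℤ) ≤ D₂ := single_add_single_nonneg _ _
  have hD₁s : ∑ v, D₁ v = 2 := sum_single_add_single _ _
  have hD₂s : ∑ v, D₂ v = 2 := sum_single_add_single _ _
  have h12 : LinEquiv G D₁ D₂ := linEquiv_pair_hypInvolution hG hD hr x y
  obtain ⟨f, hf⟩ := (linEquiv_iff_exists_eq_sub G D₁ D₂).1 h12
  have hyx : y ≠ x := (G.ne_of_adj hxy).symm
  -- `f` is not constant: `D₁(y) = 0 ≠ D₂(y)`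
  have hnc : fnMin f < fnMax f := by
    rcases (le_trans (fnMin_le f x) (le_fnMax f x)).lt_or_eq with h | h
    · exact h
    · exfalso
      have hconst : ∀ v w, f v = f w := fun v w => by
        have := le_fnMax f v; have := fnMin_le f v; have := le_fnMax f w; have := fnMin_le f w
        omega
      have hfc : f = f x • fun _ : V => (1 : ℤ) := by funext v; simp [hconst v x]
      have hΔ0 : G.lapMatrix ℤ *ᵥ f = 0 := by
        rw [hfc, Matrix.mulVec_smul, SimpleGraph.lapMatrix_mulVec_const_eq_zero, smul_zero]
      rw [hΔ0, sub_zero] at hf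
      have := congrFun hf y
      rw [hD₂, hD₁, single_add_single_apply, single_add_single_apply, if_neg hyx, if_neg hy,
        if_pos rfl] at this
      split_ifs at this <;> omega
  have hf' : D₁ = D₂ - G.lapMatrix ℤ *ᵥ (-f) := by rw [Matrix.mulVec_neg, hf]; abel
  have hnc' : fnMin (-f) < fnMax (-f) := by
    obtain ⟨a, ha⟩ := exists_eq_fnMax f
    obtain ⟨b, hb⟩ := exists_eq_fnMin f
    have h1 := le_fnMax (-f) b
    have h2 := fnMin_le (-f) a
    simp only [Pi.neg_apply] at h1 h2
    omega
  -- the two sides of the cut: `M = M(f)` and `M′ = M(−f)`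
  obtain ⟨hA1, hA2, hA3, hA4⟩ := cut_eq_of_linEquiv h2 hD₁0 hD₂0 hD₁s hf hnc
  obtain ⟨hB1, hB2, hB3, hB4⟩ := cut_eq_of_linEquiv h2 hD₂0 hD₁0 hD₂s hf' hnc'
  set M := maxLocus f with hM
  set M' := maxLocus (-f) with hM'
  -- evaluations of `D₁`, `D₂`
  have eD₁ : ∀ z, D₁ z = (if z = x then 1 else 0) + if z = ι x then 1 else 0 :=
    fun z => single_add_single_apply _ _ _
  have eD₂ : ∀ z, D₂ z = (if z = y then 1 else 0) + if z = ι y then 1 else 0 :=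
    fun z => single_add_single_apply _ _ _
  -- `x, ι x ∈ M`; `y, ι y ∈ M′`
  have hxM : x ∈ M := by
    by_contra h; have := hA1 x h; rw [eD₁, if_pos rfl] at this; split_ifs at this <;> omega
  have hιxM : ι x ∈ M := by
    by_contra h; have := hA1 (ι x) h; rw [eD₁, if_pos (rfl : ι x = ι x)] at this
    split_ifs at this <;> omega
  have hyM' : y ∈ M' := by
    by_contra h; have := hB1 y h; rw [eD₂, if_pos rfl] at this; split_ifs at this <;> omega
  have hιyM' : ι y ∈ M' := by
    by_contra h; have := hB1 (ι y) h; rw [eD₂, if_pos (rfl : ι y = ι y)] at this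
    split_ifs at this <;> omega
  -- `M` and `M′` are complementary: `f` takes only the values `max` and `max − 1`
  have hyM : y ∉ M := fun h => by
    have := hA2 y h; rw [eD₂, if_pos rfl] at this; split_ifs at this <;> omega
  have hfy : f y = fnMax f - 1 := hA4 x hxM y hxy hyM
  have hmax' : fnMax (-f) = 1 - fnMax f := by
    have := mem_maxLocus.1 hyM'
    rw [Pi.neg_apply, hfy] at this
    linarith
  have hMM' : ∀ z, z ∉ M ↔ z ∈ M' := fun z => by
    rw [mem_maxLocus, mem_maxLocus, Pi.neg_apply, hmax']
    have h1 := le_fnMax f z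
    have h2 := le_fnMax (-f) z
    rw [Pi.neg_apply, hmax'] at h2
    omega
  -- cut-neighbour counts on both sides
  have hcM : ∀ z ∈ M, D₁ z = #{u ∈ G.neighborFinset z | u ∈ M'} := fun z hz => by
    rw [hA3 z hz]
    congr 2
    ext u
    simp only [mem_filter, hMM' u]
  have hcM' : ∀ z ∈ M', D₂ z = #{u ∈ G.neighborFinset z | u ∈ M} := fun z hz => by
    rw [hB3 z hz]
    congr 2
    ext u
    simp only [mem_filter]
    rw [← not_iff_not, ← hMM' u, not_not]
  -- a cut-neighbour `w ∈ M′` of a vertex of `M` lies in `{y, ι y}`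
  have hsuppD₂ : ∀ w ∈ M', (∃ z ∈ M, G.Adj z w) → w = y ∨ w = ι y := by
    intro w hw ⟨z, hz, hzw⟩
    have h1 : 1 ≤ D₂ w := by
      rw [hcM' w hw]
      exact_mod_cast Finset.card_pos.2 ⟨z, mem_filter.2 ⟨(mem_neighborFinset _ _ _).2 hzw.symm, hz⟩⟩
    rw [eD₂] at h1
    by_contra h
    push Not at h
    rw [if_neg h.1, if_neg h.2] at h1
    omega
  -- symmetric statement: a cut-neighbour `w ∈ M` of a vertex of `M′` lies in `{x, ι x}`
  have hsuppD₁ : ∀ w ∈ M, (∃ z ∈ M', G.Adj z w) → w = x ∨ w = ι x := by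
    intro w hw ⟨z, hz, hzw⟩
    have h1 : 1 ≤ D₁ w := by
      rw [hcM w hw]
      exact_mod_cast Finset.card_pos.2 ⟨z, mem_filter.2 ⟨(mem_neighborFinset _ _ _).2 hzw.symm, hz⟩⟩
    rw [eD₁] at h1
    by_contra h
    push Not at h
    rw [if_neg h.1, if_neg h.2] at h1
    omega
  -- (C) `x` and `y` are not both fixed
  have hC : ¬ (ι x = x ∧ ι y = y) := by
    rintro ⟨hx, hy'⟩
    -- `D₁ = 2(x)`: `x` has two cut-neighbours, both in `{y, ι y} = {y}`
    have h2x : #{u ∈ G.neighborFinset x | u ∈ M'} = 2 := by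
      have := hcM x hxM
      rw [eD₁, if_pos rfl, hx, if_pos rfl] at this
      omega
    obtain ⟨a, b, hab, hset⟩ := Finset.card_eq_two.1 h2x
    have ha : a ∈ ({u ∈ G.neighborFinset x | u ∈ M'} : Finset V) := by rw [hset]; simp
    have hb : b ∈ ({u ∈ G.neighborFinset x | u ∈ M'} : Finset V) := by rw [hset]; simp
    rw [mem_filter, mem_neighborFinset] at ha hb
    have ha' := hsuppD₂ a ha.2 ⟨x, hxM, ha.1⟩
    have hb' := hsuppD₂ b hb.2 ⟨x, hxM, hb.1⟩
    rw [hy'] at ha' hb'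
    rcases ha' with rfl | rfl <;> rcases hb' with rfl | rfl <;> exact hab rfl
  refine ⟨?_, fun hxy' => ?_, hC⟩
  · -- (A) `ι x ∼ ι y`
    -- `ι x ∈ M` has a cut-neighbour `w ∈ M′`, which is `y` or `ι y`
    have h1 : 1 ≤ #{u ∈ G.neighborFinset (ι x) | u ∈ M'} := by
      have h := hcM (ι x) hιxM
      rw [eD₁, if_pos (rfl : ι x = ι x)] at h
      have : (1 : ℤ) ≤ #{u ∈ G.neighborFinset (ι x) | u ∈ M'} := by
        rw [← h]; split_ifs <;> omega
      exact_mod_cast this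
    obtain ⟨w, hw⟩ := Finset.one_le_card.1 h1
    rw [mem_filter, mem_neighborFinset] at hw
    rcases hsuppD₂ w hw.2 ⟨ι x, hιxM, hw.1⟩ with rfl | rfl
    · -- `w = y`
      by_cases hx : ι x = x
      · -- `x` fixed: `x` has two cut-neighbours; the other one is `ι y`
        have h2x : #{u ∈ G.neighborFinset x | u ∈ M'} = 2 := by
          have := hcM x hxM
          rw [eD₁, if_pos rfl, hx, if_pos rfl] at this
          omega
        obtain ⟨a, b, hab, hset⟩ := Finset.card_eq_two.1 h2x
        have ha : a ∈ ({u ∈ G.neighborFinset x | u ∈ M'} : Finset V) := by rw [hset]; simp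
        have hb : b ∈ ({u ∈ G.neighborFinset x | u ∈ M'} : Finset V) := by rw [hset]; simp
        rw [mem_filter, mem_neighborFinset] at ha hb
        have ha' := hsuppD₂ a ha.2 ⟨x, hxM, ha.1⟩
        have hb' := hsuppD₂ b hb.2 ⟨x, hxM, hb.1⟩
        rw [hx]
        rcases ha' with rfl | rfl
        · rcases hb' with rfl | rfl
          · exact absurd rfl hab
          · exact hb.1
        · exact ha.1
      · -- `x` not fixed: `w = y` has the two cut-neighbours `x, ι x`, so `D₂(y) ≥ 2`, `ι y = y`
        have h2y : 2 ≤ D₂ w := by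
          rw [hcM' w hyM']
          have hsub : ({x, ι x} : Finset V) ⊆ {u ∈ G.neighborFinset w | u ∈ M} := by
            intro u hu
            simp only [mem_insert, mem_singleton] at hu
            rcases hu with rfl | rfl
            · exact mem_filter.2 ⟨(mem_neighborFinset _ _ _).2 hxy.symm, hxM⟩
            · exact mem_filter.2 ⟨(mem_neighborFinset _ _ _).2 hw.1.symm, hιxM⟩
          have := Finset.card_le_card hsub
          rw [Finset.card_pair (Ne.symm hx)] at this
          exact_mod_cast this
        rw [eD₂, if_pos rfl] at h2y
        have hyy : w = ι w := by
          by_contra h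
          rw [if_neg h] at h2y
          omega
        rw [← hyy]
        exact hw.1
    · exact hw.1
  · -- (B) `x ∼ ι y` with `ι x ≠ x`, `ι y ≠ y` would be a third cut edge at `x`
    by_contra h
    push Not at h
    have h1 : D₁ x = 1 := by
      rw [eD₁, if_pos rfl, if_neg (Ne.symm h.1)]
      norm_num
    have h2' : 2 ≤ D₁ x := by
      rw [hcM x hxM]
      have hsub : ({y, ι y} : Finset V) ⊆ {u ∈ G.neighborFinset x | u ∈ M'} := by
        intro u hu
        simp only [mem_insert, mem_singleton] at hu
        rcases hu with rfl | rfl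
        · exact mem_filter.2 ⟨(mem_neighborFinset _ _ _).2 hxy, hyM'⟩
        · exact mem_filter.2 ⟨(mem_neighborFinset _ _ _).2 hxy', hιyM'⟩
      have := Finset.card_le_card hsub
      rw [Finset.card_pair (Ne.symm h.2)] at this
      exact_mod_cast this
    omega

/-- **`ι` is an involution of `G`** («Therefore `ι` is an automorphism, and clearly `ι ∘ ι` is the
identity»). [cite: BakerNorine2009, Theorem 51 (proof of (1) ⇒ (2))] -/
theorem isInvolutiveAut_hypInvolution : IsInvolutiveAut G (hypInvolution G D) where
  involutive := hypInvolution_hypInvolution hG h2 hD hr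
  map_adj := fun x y hxy => by
    by_cases hy : y = hypInvolution G D x
    · rw [hy, hypInvolution_hypInvolution hG h2 hD hr]
      exact (hy ▸ hxy).symm
    · exact (hypInvolution_edge hG h2 hD hr hxy hy).1

/-- `ι` is mixing. [cite: BakerNorine2009, Theorem 51 (proof) with Lemma 45] -/
theorem isMixing_hypInvolution : IsMixing G (hypInvolution G D) := by
  intro x y hxy hx hy
  have hy' : y ≠ hypInvolution G D x := by rw [hx]; exact (G.ne_of_adj hxy).symm
  exact (hypInvolution_edge hG h2 hD hr hxy hy').2.2 ⟨hx, hy⟩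

/-- `ι` has simple edge orbits: `G/ι` has no multiple edges (the cut `δ(M(f))` has exactly the
two edges `e, ι(e)`). [cite: BakerNorine2009, Theorem 51 (proof of (1) ⇒ (2))] -/
theorem hasSimpleEdgeOrbits_hypInvolution : HasSimpleEdgeOrbits G (hypInvolution G D) := by
  intro x y hxy hxy'
  by_cases hy : y = hypInvolution G D x
  · -- then `ι y = x`, and `x ∼ ι y = x` is impossible
    rw [hy, hypInvolution_hypInvolution hG h2 hD hr] at hxy'
    exact absurd hxy' G.irrefl
  · exact (hypInvolution_edge hG h2 hD hr hxy hy).2.1 hxy'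

end HypInvolution

/-! ### §3 (2) ⇒ (3): tree quotients are mixing; the orbit map onto the tree -/

/-- **(2) ⇒ (3), mixing**: if `G/ι` is a tree and `G` is 2-edge-connected then `ι` is mixing («the
set of edges `{e, ι(e)}` is the preimage of an edge of `G/ι`, and therefore forms a cut in `G`. It
follows that `e ≠ ι(e)`»: an edge with both ends fixed would by itself be the cut over a bridge of
the tree). [cite: BakerNorine2009, Theorem 51 (proof of (2) ⇒ (3))] -/
theorem isMixing_of_isTree_quotientGraph (h2 : G.IsEdgeConnected 2) {ι : V → V}
    (hι : IsInvolutiveAut G ι) (hT : (quotientGraph G ι).IsTree) : IsMixing G ι := by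
  classical
  intro x y hxy hx hy
  set T := quotientGraph G ι with hTdef
  set π : V → Quotient (orbitRel ι) := Quotient.mk _ with hπdef
  have hπ : IsOrbitMap ι π := isOrbitMap_quotientMk hι.involutive
  have hne : π x ≠ π y := fun h => by
    rcases (hπ.apply_eq_iff x y).1 h with h' | h'
    · exact G.ne_of_adj hxy h'.symm
    · rw [hx] at h'; exact G.ne_of_adj hxy h'.symm
  have hadj : T.Adj (π x) (π y) := imageGraph_adj.2 ⟨hne, x, y, rfl, rfl, hxy⟩
  have hbr : ¬ (T.deleteEdges {s(π x, π y)}).Reachable (π x) (π y) :=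
    (isBridge_iff (G := T)).1 (isAcyclic_iff_forall_adj_isBridge.1 hT.isAcyclic hadj)
  -- the pulled-back component `A` of `π x` in `T − e′`
  set A : Finset V := univ.filter fun z => (T.deleteEdges {s(π x, π y)}).Reachable (π x) (π z)
    with hA
  have hxA : x ∈ A := mem_filter.2 ⟨mem_univ _, Reachable.refl _⟩
  have hyA : y ∉ A := fun h => hbr (mem_filter.1 h).2
  -- every edge leaving `A` is the edge `xy`
  have hcut : ∀ z ∈ A, ∀ w ∈ G.neighborFinset z \ A, z = x ∧ w = y := by
    intro z hz w hw
    rw [Finset.mem_sdiff, mem_neighborFinset] at hw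
    have hzr := (mem_filter.1 hz).2
    have hπzw : π z ≠ π w := fun h => hw.2 (mem_filter.2 ⟨mem_univ _, h ▸ hzr⟩)
    have hadj' : T.Adj (π z) (π w) := imageGraph_adj.2 ⟨hπzw, z, w, rfl, rfl, hw.1⟩
    have hedge : s(π z, π w) = s(π x, π y) := by
      by_contra hne'
      have : (T.deleteEdges {s(π x, π y)}).Adj (π z) (π w) := by
        rw [deleteEdges_adj]
        exact ⟨hadj', by simpa using hne'⟩
      exact hw.2 (mem_filter.2 ⟨mem_univ _, hzr.trans this.reachable⟩)
    rcases Sym2.eq_iff.1 hedge with ⟨h1, h2⟩ | ⟨h1, h2⟩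
    · constructor
      · rcases (hπ.apply_eq_iff x z).1 h1.symm with h | h
        · exact h
        · rw [h, hx]
      · rcases (hπ.apply_eq_iff y w).1 h2.symm with h | h
        · exact h
        · rw [h, hy]
    · exact absurd (h1 ▸ hzr) hbr
  -- hence the cut has at most one edge, contradicting 2-edge-connectivity
  have hle : ∑ z ∈ A, #(G.neighborFinset z \ A) ≤ 1 := by
    calc ∑ z ∈ A, #(G.neighborFinset z \ A) ≤ ∑ z ∈ A, if z = x then 1 else 0 := by
          refine Finset.sum_le_sum fun z hz => ?_
          split_ifs with hzx
          · rw [Finset.card_le_one]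
            intro a ha b hb
            rw [(hcut z hz a ha).2, (hcut z hz b hb).2]
          · rw [Nat.le_zero, Finset.card_eq_zero, Finset.eq_empty_iff_forall_notMem]
            exact fun w hw => hzx (hcut z hz w hw).1
      _ ≤ 1 := by rw [Finset.sum_ite_eq', if_pos hxA]
  have hge := (isEdgeConnected_iff_forall_le_sum (G := G) 2).1 h2 A ⟨x, hxA⟩
    ⟨y, Finset.mem_compl.2 hyA⟩
  omega

/-- Condition (2) of Theorem 51: «There exists an involution `ι : G → G` such that `G/ι` is a
tree» (tree = the simple quotient is a tree and there are no multiple edges).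
[cite: BakerNorine2009, Theorem 51 (2)] -/
def HasTreeInvolution (G : SimpleGraph V) : Prop :=
  ∃ ι : V → V, IsInvolutiveAut G ι ∧ (quotientGraph G ι).IsTree ∧ HasSimpleEdgeOrbits G ι

/-- Condition (3) of Theorem 51: «There exists a non-degenerate degree two harmonic morphism `φ`
from `G` to a tree, or `|V(G)| = 2`». [cite: BakerNorine2009, Theorem 51 (3)] -/
def HasDegreeTwoMapToTree (G : SimpleGraph V) [DecidableRel G.Adj] : Prop :=
  (∃ (W : Type u) (_ : Fintype W) (_ : DecidableEq W) (T : SimpleGraph W) (_ : DecidableRel T.Adj)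
      (φ : V → W), T.IsTree ∧ IsHarmonicMorphism G T φ ∧ (∀ x, 1 ≤ horizMult G T φ x) ∧
        ∀ w, harmonicDegree G T φ w = 2) ∨ Fintype.card V = 2

/-- **(2) ⇒ (3)**: the orbit map of a tree involution is a non-degenerate degree-two harmonic
morphism onto the tree `G/ι` (Lemma 45; `|V(G)| > 2`). [cite: BakerNorine2009, Theorem 51
(proof of (2) ⇔ (3))] -/
theorem hasDegreeTwoMapToTree_of_hasTreeInvolution (hG : G.Connected) (h2 : G.IsEdgeConnected 2)
    (hV : 2 < Fintype.card V) (h : HasTreeInvolution G) : HasDegreeTwoMapToTree G := by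
  classical
  obtain ⟨ι, hι, hT, hs⟩ := h
  have hm : IsMixing G ι := isMixing_of_isTree_quotientGraph h2 hι hT
  letI : Fintype (Quotient (orbitRel ι)) := Fintype.ofFinite _
  have hπ : IsOrbitMap ι (Quotient.mk (orbitRel ι)) := isOrbitMap_quotientMk hι.involutive
  refine Or.inl ⟨Quotient (orbitRel ι), inferInstance, inferInstance, quotientGraph G ι,
    inferInstance, Quotient.mk _, hT, hπ.isHarmonicMorphism hι hm hs,
    hπ.one_le_horizMult hι hm hs hG hV, hπ.harmonicDegree_eq_two hι hm hs hG hV⟩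

/-! ### §4 (3) ⇒ (1) -/

/-- **(3) ⇒ (1)**: for a non-degenerate degree-two harmonic morphism `φ` onto a tree,
`D = φ^*((y₀))` has degree `2` and `r(D) = 1` («`D ∼ φ^*((φ(x))) ≥ m_φ(x)(x)`»; `g ≥ 2`).
[cite: BakerNorine2009, Theorem 51 (proof of (3) ⇒ (1))] -/
theorem isHyperelliptic_of_hasDegreeTwoMapToTree (hG : G.Connected) (hg : 2 ≤ genus G)
    (h : HasDegreeTwoMapToTree G) : IsHyperelliptic G := by
  rcases h with ⟨W, _, _, T, _, φ, hT, hφ, hnd, hdeg⟩ | hV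
  · haveI : Nonempty V := hG.nonempty
    obtain ⟨t₀⟩ : Nonempty W := ⟨φ (Classical.arbitrary V)⟩
    set D := divPullback G T φ (Pi.single t₀ 1) with hDdef
    have hDs : ∑ v, D v = 2 := by
      rw [hDdef, hφ.sum_divPullback hT.connected t₀, hdeg t₀, Finset.sum_pi_single']
      simp
    refine (isHyperelliptic_iff_exists_one_le_rank hG hg).2 ⟨D, hDs, ?_⟩
    rw [show (1 : ℤ) = ((1 : ℕ) : ℤ) from rfl, le_rank_iff]
    intro E hE hEs
    obtain ⟨x, rfl⟩ := eq_single_of_nonneg_of_sum_eq_one hE (by exact_mod_cast hEs)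
    -- `(t₀) ∼ (φ x)` in the tree, so `D ∼ φ^*((φ x)) ≥ (x)`
    have h1 : LinEquiv T (Pi.single t₀ (1 : ℤ)) (Pi.single (φ x) 1) :=
      linEquiv_of_isTree hT (by simp [Finset.sum_pi_single'])
    have h2 := hφ.linEquiv_divPullback h1
    refine ⟨divPullback G T φ (Pi.single (φ x) 1) - Pi.single x 1, fun z => ?_, h2.sub_right _⟩
    rw [Pi.zero_apply, Pi.sub_apply, divPullback_apply]
    by_cases hz : z = x
    · rw [hz]
      simp only [Pi.single_eq_same, mul_one]
      have := hnd x
      omega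
    · rw [Pi.single_eq_of_ne hz]
      have : (0 : ℤ) ≤ (Pi.single (φ x) 1 : W → ℤ) (φ z) := by
        by_cases h : φ z = φ x
        · rw [h]; simp
        · simp [h]
      have := Int.natCast_nonneg (horizMult G T φ z)
      nlinarith
  · exfalso
    have := genus_le_zero_of_card_le_two hG hV.le
    omega

/-! ### §5 (1) ⇒ (2) and Theorem 51 -/

omit [DecidableEq V] in
/-- A graph of genus `≥ 2` (simple, connected) has at least three vertices.
[cite: BakerNorine2009, Theorem 51 (proof: «in what follows we assume `|V(G)| > 2`»)] -/
theorem two_lt_card_of_two_le_genus (hG : G.Connected) (hg : 2 ≤ genus G) : 2 < Fintype.card V := by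
  by_contra h
  have := genus_le_zero_of_card_le_two hG (by omega)
  omega

section OneTwo

variable (hG : G.Connected) (h2 : G.IsEdgeConnected 2) {D : V → ℤ} (hD : ∑ v, D v = 2)
  (hr : 1 ≤ rank G D) (hV : 2 < Fintype.card V)
include hG h2 hD hr hV

/-- **(1) ⇒ (2), the tree**: `G/ι` is a tree for the involution of `D` («`φ^*((x)) = (x) + (ι(x))
∼ D ∼ (y) + (ι(y)) = φ^*((y))`. Therefore, by Theorem 30, `(x) ∼ (y)` […]. It follows from Lemma 1
that `G/ι` is a tree»). [cite: BakerNorine2009, Theorem 51 (proof of (1) ⇒ (2))] -/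
theorem isTree_quotientGraph_hypInvolution : (quotientGraph G (hypInvolution G D)).IsTree := by
  classical
  set ι := hypInvolution G D with hιdef
  have hι : IsInvolutiveAut G ι := isInvolutiveAut_hypInvolution hG h2 hD hr
  have hm : IsMixing G ι := isMixing_hypInvolution hG h2 hD hr
  have hs : HasSimpleEdgeOrbits G ι := hasSimpleEdgeOrbits_hypInvolution hG h2 hD hr
  letI : Fintype (Quotient (orbitRel ι)) := Fintype.ofFinite _
  have hπ : IsOrbitMap ι (Quotient.mk (orbitRel ι)) := isOrbitMap_quotientMk hι.involutive
  haveI : Nontrivial (Quotient (orbitRel ι)) := hπ.nontrivial hV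
  have hharm : IsHarmonicMorphism G (quotientGraph G ι) (Quotient.mk (orbitRel ι)) :=
    hπ.isHarmonicMorphism hι hm hs
  have hTc : (quotientGraph G ι).Connected := imageGraph_connected hπ.surjective hG
  rw [← forall_linEquiv_single_iff_isTree hTc]
  intro p q
  obtain ⟨a, rfl⟩ := hπ.surjective p
  obtain ⟨b, rfl⟩ := hπ.surjective q
  apply hharm.linEquiv_of_linEquiv_divPullback hG hTc hπ.surjective
  rw [hπ.divPullback_single hι hm hs hG hV a, hπ.divPullback_single hι hm hs hG hV b]
  exact linEquiv_pair_hypInvolution hG hD hr a b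

/-- **(1) ⇒ (2)**. [cite: BakerNorine2009, Theorem 51] -/
theorem hasTreeInvolution_of_rank : HasTreeInvolution G :=
  ⟨hypInvolution G D, isInvolutiveAut_hypInvolution hG h2 hD hr,
    isTree_quotientGraph_hypInvolution hG h2 hD hr hV, hasSimpleEdgeOrbits_hypInvolution hG h2 hD hr⟩

end OneTwo

/-- **Theorem 51, (1) ⇔ (2)**: a 2-edge-connected graph of genus `g ≥ 2` is hyperelliptic iff it
has an involution whose quotient is a tree. [cite: BakerNorine2009, Theorem 51] -/
theorem isHyperelliptic_iff_hasTreeInvolution (hG : G.Connected) (h2 : G.IsEdgeConnected 2)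
    (hg : 2 ≤ genus G) : IsHyperelliptic G ↔ HasTreeInvolution G := by
  have hV := two_lt_card_of_two_le_genus hG hg
  constructor
  · rintro ⟨D, hD, hr⟩
    exact hasTreeInvolution_of_rank hG h2 hD hr.symm.le hV
  · intro h
    exact isHyperelliptic_of_hasDegreeTwoMapToTree hG hg
      (hasDegreeTwoMapToTree_of_hasTreeInvolution hG h2 hV h)

/-- **Theorem 51, (1) ⇔ (3)**: a 2-edge-connected graph of genus `g ≥ 2` is hyperelliptic iff it
has a non-degenerate degree-two harmonic morphism to a tree (or `|V(G)| = 2`).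
[cite: BakerNorine2009, Theorem 51] -/
theorem isHyperelliptic_iff_hasDegreeTwoMapToTree (hG : G.Connected) (h2 : G.IsEdgeConnected 2)
    (hg : 2 ≤ genus G) : IsHyperelliptic G ↔ HasDegreeTwoMapToTree G := by
  have hV := two_lt_card_of_two_le_genus hG hg
  constructor
  · intro h
    exact hasDegreeTwoMapToTree_of_hasTreeInvolution hG h2 hV
      ((isHyperelliptic_iff_hasTreeInvolution hG h2 hg).1 h)
  · exact isHyperelliptic_of_hasDegreeTwoMapToTree hG hg

/-- **Theorem 51, (2) ⇔ (3)**. [cite: BakerNorine2009, Theorem 51] -/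
theorem hasTreeInvolution_iff_hasDegreeTwoMapToTree (hG : G.Connected) (h2 : G.IsEdgeConnected 2)
    (hg : 2 ≤ genus G) : HasTreeInvolution G ↔ HasDegreeTwoMapToTree G := by
  rw [← isHyperelliptic_iff_hasTreeInvolution hG h2 hg, isHyperelliptic_iff_hasDegreeTwoMapToTree hG h2 hg]

/-! ### §6 Corollary 53, Corollary 54, Remark 56 -/

section TreeInvolution

variable (hG : G.Connected) (h2 : G.IsEdgeConnected 2) (hV : 2 < Fintype.card V) {ι : V → V}
  (hι : IsInvolutiveAut G ι) (hT : (quotientGraph G ι).IsTree) (hs : HasSimpleEdgeOrbits G ι)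
include hG h2 hV hι hT hs

/-- **Corollary 53**: «for any involution `ι` for which `G/ι` is a tree, we have
`(x) + (ι(x)) ∼ (y) + (ι(y))` for all `x, y ∈ V(G)`». [cite: BakerNorine2009, Corollary 53] -/
theorem linEquiv_pair_of_isTree_quotientGraph (x y : V) :
    LinEquiv G (Pi.single x 1 + Pi.single (ι x) 1) (Pi.single y 1 + Pi.single (ι y) 1) := by
  classical
  have hm : IsMixing G ι := isMixing_of_isTree_quotientGraph h2 hι hT
  letI : Fintype (Quotient (orbitRel ι)) := Fintype.ofFinite _
  have hπ : IsOrbitMap ι (Quotient.mk (orbitRel ι)) := isOrbitMap_quotientMk hι.involutive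
  have hharm : IsHarmonicMorphism G (quotientGraph G ι) (Quotient.mk (orbitRel ι)) :=
    hπ.isHarmonicMorphism hι hm hs
  have h1 : LinEquiv (quotientGraph G ι) (Pi.single (Quotient.mk (orbitRel ι) x) (1 : ℤ))
      (Pi.single (Quotient.mk (orbitRel ι) y) 1) :=
    linEquiv_of_isTree hT (by simp [Finset.sum_pi_single'])
  have h2' := hharm.linEquiv_divPullback h1
  rwa [hπ.divPullback_single hι hm hs hG hV x, hπ.divPullback_single hι hm hs hG hV y] at h2'

/-- **Corollary 53**: «In particular, `r((x) + (ι(x))) = 1` for all `x ∈ V(G)`» (`g ≥ 2`).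
[cite: BakerNorine2009, Corollary 53] -/
theorem rank_pair_eq_one_of_isTree_quotientGraph (hg : 2 ≤ genus G) (x : V) :
    rank G (Pi.single x 1 + Pi.single (ι x) 1) = 1 := by
  haveI : Nonempty V := hG.nonempty
  refine (rank_eq_one_iff_of_sum_eq_two hG hg (sum_single_add_single _ _)).2 ?_
  rw [show (1 : ℤ) = ((1 : ℕ) : ℤ) from rfl, le_rank_iff]
  intro E hE hEs
  obtain ⟨z, rfl⟩ := eq_single_of_nonneg_of_sum_eq_one hE (by exact_mod_cast hEs)
  -- `(x) + (ι x) − (z) ∼ (z) + (ι z) − (z) = (ι z) ≥ 0`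
  refine ⟨Pi.single (ι z) 1, fun v => ?_, ?_⟩
  · by_cases hv : v = ι z
    · subst hv; simp
    · simp [hv]
  · have := (linEquiv_pair_of_isTree_quotientGraph hG h2 hV hι hT hs x z).sub_right (Pi.single z 1)
    rwa [add_sub_cancel_left] at this

/-- A tree involution makes `G` hyperelliptic ((2) ⇒ (1) directly). [cite: BakerNorine2009,
Theorem 51 and Corollary 53] -/
theorem isHyperelliptic_of_isTree_quotientGraph (hg : 2 ≤ genus G) : IsHyperelliptic G := by
  obtain ⟨x⟩ := hG.nonempty
  exact ⟨_, sum_single_add_single x (ι x),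
    rank_pair_eq_one_of_isTree_quotientGraph hG h2 hV hι hT hs hg x⟩

/-- **Remark 56**: «if `G` is a 2-edge-connected hyperelliptic graph and `r((x) + (y)) = 1` for
some `x, y ∈ V(G)`, then `y = ι(x)`» (for a tree involution `ι`; `g ≥ 2`).
[cite: BakerNorine2009, Remark 56] -/
theorem eq_apply_of_rank_pair_eq_one (hg : 2 ≤ genus G) {x y : V}
    (h : rank G (Pi.single x 1 + Pi.single y 1) = 1) : y = ι x := by
  have h1 := rank_pair_eq_one_of_isTree_quotientGraph hG h2 hV hι hT hs hg x
  have h3 : LinEquiv G (Pi.single x 1 + Pi.single y 1) (Pi.single x 1 + Pi.single (ι x) 1) :=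
    linEquiv_of_rank_eq_one hG hg (sum_single_add_single _ _) (sum_single_add_single _ _) h h1
  have h4 := h3.sub_right (Pi.single x 1)
  rw [add_sub_cancel_left, add_sub_cancel_left] at h4
  exact (linEquiv_single_imp_eq_iff_isEdgeConnected_two hG).2 h2 _ _ h4

/-- A tree involution is the involution of every degree-`2` divisor class with `r = 1`: `ι =
hypInvolution G D`. [cite: BakerNorine2009, Corollary 53 with Remark 56] -/
theorem eq_hypInvolution_of_isTree_quotientGraph (hg : 2 ≤ genus G) {D : V → ℤ} (hD : ∑ v, D v = 2)
    (hr : 1 ≤ rank G D) (x : V) : ι x = hypInvolution G D x := by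
  haveI : Nonempty V := hG.nonempty
  have hr1 : rank G (Pi.single x 1 + Pi.single (hypInvolution G D x) 1) = 1 := by
    rw [← (linEquiv_single_add_hypInvolution hG hD hr x).rank_eq]
    exact (rank_eq_one_iff_of_sum_eq_two hG hg hD).2 hr
  exact (eq_apply_of_rank_pair_eq_one hG h2 hV hι hT hs hg hr1).symm

end TreeInvolution

/-- **Corollary 54**: «If `G` is a 2-edge-connected graph of genus at least `2`, then there is at
most one involution `ι` of `G` whose quotient is a tree.» [cite: BakerNorine2009, Corollary 54] -/
theorem tree_involution_unique (hG : G.Connected) (h2 : G.IsEdgeConnected 2) (hg : 2 ≤ genus G)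
    {ι ι' : V → V} (hι : IsInvolutiveAut G ι) (hT : (quotientGraph G ι).IsTree)
    (hs : HasSimpleEdgeOrbits G ι) (hι' : IsInvolutiveAut G ι') (hT' : (quotientGraph G ι').IsTree)
    (hs' : HasSimpleEdgeOrbits G ι') : ι = ι' := by
  have hV := two_lt_card_of_two_le_genus hG hg
  funext x
  -- `r((x) + (ι x)) = 1 = r((x) + (ι′ x))`, so `(ι x) ∼ (ι′ x)` by Proposition 44
  have h1 := rank_pair_eq_one_of_isTree_quotientGraph hG h2 hV hι' hT' hs' hg x
  exact (eq_apply_of_rank_pair_eq_one hG h2 hV hι hT hs hg h1).symm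

end Literature.Combinatorics.SimpleGraph.BakerNorine
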